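import Literature.NumberTheory.LFunctions.XiTiltedSecondMoment
import HarnessLib

/-!
# The ladder tail lemma for `ξ`: the two-piece curvature floor in closed form

`Literature/NumberTheory/LFunctions/`. For the rows `d ≥ 5` of the Jensen track's THEOREM A (design
HOME/jensen/p1/THEOREM-A-ASSEMBLY.md v0.3 (E)) the bulk floor must keep the `k/u²` part of
`W_k″ = k/u² + V(u)`: with `c = a + 1/(16a)` (eng-3, LADDER-BL.md (4.2)),

  `k/c² + 16πe^{4(a−τ)} ≤ W_k″(u)`   for every `u ≥ a − τ`, `u > 0`,

whenever `k ≤ 4a·πe^{4a}` (which holds at a critical point `a` of `W_k` by the upper envelope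
`−Φ′/Φ ≤ 4πe^{4u} − 9`) and `τ ≥ 0` (`xi_floor_twoPiece`). It is `XiTiltedSecondMoment.xiPotential_floor_right`
with its hypothesis `k/c² ≤ 16π(e^{4c} − e^{4(a−τ)})` discharged from `e^{1/(4a)} ≥ 1 + 1/(4a)`.
Theorems only.

References: Griffin–Ono–Rolen–Zagier, PNAS 116 (2019), Thm 7 / §5.1 [GORZPNAS2019].
-/

noncomputable section

open Set

namespace Literature.NumberTheory.LFunctions

/-- **Two-piece curvature floor in closed form**: if `k ≤ 4a·πe^{4a}`, `a > 0`, `τ ≥ 0`, then for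
every `u ≥ a − τ` with `u > 0`,
`k/(a + 1/(16a))² + 16πe^{4(a−τ)} ≤ k/u² + (Φ′(u)² − Φ(u)Φ″(u))/Φ(u)²`.
[cite: GORZPNAS2019, Thm 7 and §5.1] -/
theorem xi_floor_twoPiece (k : ℕ) {a τ : ℝ} (ha : 0 < a) (hτ : 0 ≤ τ)
    (hk : (k : ℝ) ≤ 4 * a * (Real.pi * Real.exp (4 * a))) :
    ∀ u : ℝ, 0 < u → a - τ ≤ u →
      (k : ℝ) / (a + 1 / (16 * a)) ^ 2 + 16 * Real.pi * Real.exp (4 * (a - τ)) ≤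
        (k : ℝ) / u ^ 2 +
          (deBruijnPhiDeriv u ^ 2 - deBruijnPhi u * deBruijnPhiDeriv₂ u) / deBruijnPhi u ^ 2 := by
  set c : ℝ := a + 1 / (16 * a) with hc
  have h16 : 0 < 1 / (16 * a) := by positivity
  have hca : a < c := by rw [hc]; linarith
  have hc0 : 0 < c := lt_trans ha hca
  have hπ : 0 < Real.pi := Real.pi_pos
  -- `e^{4c} − e^{4(a−τ)} ≥ e^{4a}(e^{1/(4a)} − 1) ≥ e^{4a}/(4a)`
  have hexp : Real.exp (4 * a) / (4 * a) ≤ Real.exp (4 * c) - Real.exp (4 * (a - τ)) := by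
    have e1 : Real.exp (4 * c) = Real.exp (4 * a) * Real.exp (1 / (4 * a)) := by
      rw [← Real.exp_add]; congr 1; rw [hc]; field_simp; ring
    have h1 : 1 / (4 * a) + 1 ≤ Real.exp (1 / (4 * a)) := Real.add_one_le_exp _
    have h2 : Real.exp (4 * (a - τ)) ≤ Real.exp (4 * a) := Real.exp_le_exp.2 (by linarith)
    have h3 : Real.exp (4 * a) / (4 * a) = Real.exp (4 * a) * (1 / (4 * a)) := by ring
    rw [e1, h3]
    nlinarith [Real.exp_pos (4 * a), h1, h2]
  -- hence the hypothesis of `xiPotential_floor_right`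
  have hcond : (k : ℝ) / c ^ 2 ≤ 16 * Real.pi * (Real.exp (4 * c) - Real.exp (4 * (a - τ))) := by
    have h1 : (k : ℝ) / c ^ 2 ≤ (k : ℝ) / a ^ 2 :=
      div_le_div_of_nonneg_left (Nat.cast_nonneg k) (by positivity) (pow_le_pow_left₀ ha.le hca.le 2)
    have h2 : (k : ℝ) / a ^ 2 ≤ 4 * (Real.pi * Real.exp (4 * a)) / a := by
      rw [div_le_div_iff₀ (by positivity) ha]
      nlinarith [hk, ha]
    have h3 : 4 * (Real.pi * Real.exp (4 * a)) / a = 16 * Real.pi * (Real.exp (4 * a) / (4 * a)) := by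
      field_simp; ring
    have h4 : 16 * Real.pi * (Real.exp (4 * a) / (4 * a)) ≤
        16 * Real.pi * (Real.exp (4 * c) - Real.exp (4 * (a - τ))) :=
      mul_le_mul_of_nonneg_left hexp (by positivity)
    linarith
  intro u hu hbu
  exact xiPotential_floor_right k (b := a - τ) (c := c) hcond u hu hbu

end Literature.NumberTheory.LFunctions
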